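import Summits.CriticalPhenomena.PercolationContinuityZ3.Theorems.PercNearOneGluingNoHeavyQuantRootDecPartnerLemma
import Summits.CriticalPhenomena.PercolationContinuityZ3.Theorems.PercNearOneGluingNoHeavyQuantDIBStarBridge
import Summits.CriticalPhenomena.PercolationContinuityZ3.Theorems.PercNearOneGluingNoHeavyQuantIndepBlobOneLightCorner
import HarnessLib

/-!
# QUANT lane R8, Conjecture DIB\* — ARCHITECTURE FS tools (lead g18): the EXACT giants ⊗ smalls factorisation of a branch,
# Markov on the closed mass as a TERM rule, and rule δ½ ('a light giant sends the rest into the kernel half')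

builds on p205010 (kernel theorem, internal audit signed; external expert review pending)

Support file (`--supports stmt-CriticalPhenomena-4575`), QUANT lane lead (gen 18); memo
`run/shared/lean/prim/quant/prim-quant-lead-g18/LEAD-NOTES-G18.md` N35.  Theorems only, no definitions, no sorries, standard axioms;
vocabulary of `…QuantRootReduction` / `…QuantDIBStar` (`TERM[s, a, g, j] = P(s + Σ_{k open} a k ≥ j+1)`).

CONTEXT.  T-DIB ≡ `Quant.IndepBlob.StepLemmaFS` (lead g17, p259002): one floor split (rule φ, `RootDec.term_ge_of_floorSplit`) of a hard
instance on a blob `k`, the OPEN branch `TERM[s + a k, a[k↦0], g, j]` and the CLOSED branch `TERM[s, a[k↦0], g, j]` certified at two floors.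
The lead-g18 numerics (N35; kit j129614: 1 326 563 exact hard instances / 0; kit cell-map jobs j130204/j130205) say that with `k` = the largest
blob the minimal complete certificate menu is {exact ∨ (this file), γ = the inductive credit row, Markov (this file), α′ = EKR size row,
ε = Cantelli}; the witness rule ∧ is redundant once Markov is present, and ε is needed exactly on 'redundant' open branches (many small
blobs), where every credit-type row is blind (it never certifies a floor above `√(max gate)`).  This file supplies the three missing
KERNEL pieces of that menu:

* `Quant.RootDec.one_sub_term_eq_giants` — **EXACT giants ⊗ smalls factorisation**: for any finset `G` of giants (`j + 1 ≤ s + a k`),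
  `1 − TERM[s, a, g, j] = (∏_{k∈G} (1 − g k)) · (1 − TERM[s, a|_{G ↦ 0}, g, j])` — the branch fails iff every giant is closed AND the
  smalls fail (independence).  `term_ge_disj_giants` (p258645) is the case 'smalls ≥ 0'; here the smalls' own certificate `w` enters:
  `term_ge_of_giants_smalls` (`z ≤ 1 − ∏_G(1 − g)·(1 − w)` and `w ≤ TERM[smalls]` ⟹ `z ≤ TERM`).
* `Quant.RootDec.term_ge_of_markov` — **Markov on the closed mass**: `s ≤ j`, `A = Σ a > j − s`, `m = Σ a·g` ⟹
  `(m − (j − s))/(A − (j − s)) ≤ TERM[s, a, g, j]` (wrapper of census-1/p1's `IndepBlob.heavy_fail_markov`).  At LOW floors this is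
  the right closed-branch row: the credit row needs `m > 2(j − s)` at every floor, Markov only `m > (j − s) + z·(A − (j − s))`.
* `Quant.RootDec.term_ge_of_lightGiant_half` — **rule δ½**: a giant `k` (`j + 1 ≤ s + a k`) of ANY gate with `x ≤ g k + (1 − g k)·w`,
  and the rest certified at a floor `w ≤ 1/2` by the KERNEL half of DIB\* (`term_ge_of_credit_of_le_half`, lead g15 / typer g17)
  ⟹ `x ≤ TERM`.  The point (`lightGiant_floor_le_half`): the floor the rest needs behind a light giant of gate `g ≥ 2x − 1` — in
  particular behind EVERY positive-credit light (`g > x² ≥ 2x − 1`, `two_mul_sub_one_le_sq`) — is `(x − g)/(1 − g) ≤ 1/2`, i.e. INSIDE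
  the proved half of DIB\*: light giants created by a sure part never need the conjecture.
* `Quant.RootDec.term_ge_of_giants_half` — the same behind a whole finset of giants: `∏_G(1 − g)·(1 − w) ≤ 1 − x`, smalls certified
  at `w ≤ 1/2` by the kernel half ⟹ `x ≤ TERM`; `giants_halfFloor_le_half`: if `∏_G (1 − g) ≤ 2(1 − x)` (automatic as soon as ONE
  giant has gate `≥ 2x − 1`) the floor `w⋆ = 1 − (1 − x)/∏_G(1 − g)` that makes the product condition an equality is `≤ 1/2`.

Consequence recorded in N35 and used in `…QuantStepFSSure` (lead g18): the case 'the largest blob is SURE' of the FS step is a theorem.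

NOVELTY.  presearch: 'lower-bound the tail of a weighted Bernoulli sum by factorising over the summands that alone reach the level;
Markov on the complementary mass' → folklore ingredients, no statement of this form in print (corpus hybrid + vsearch: Paley–Zygmund /
second-moment pages; galaxy 'giant component|one large summand': unrelated).  [this work; this lane's census]; the gluing rows served
[cite: KozmaNitzan2024, Conjecture 3 (p. 15)]; product weights [cite: Grimmett1999, §1.3 p. 10].
-/

namespace Summit.CriticalPhenomena.PercolationContinuityZ3.Theorems

namespace Quant

namespace RootDec

open Finset

variable {κ : Type} [Fintype κ] [DecidableEq κ]

/-- product-Bernoulli weight of the set `W` of open blobs (as in `…QuantRootReduction`) -/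
local notation3 "wt[" g ", " W "]" => ∏ k, (if k ∈ (W : Finset κ) then (g : κ → ℝ) k else 1 - (g : κ → ℝ) k)

/-- the TERM tail `P(s + Σ_{k open} a k ≥ j+1)` (as in `…QuantRootReduction`) -/
local notation3 "TERM[" s ", " a ", " g ", " j "]" =>
  ∑ W : Finset κ, wt[g, W] * (if (j : ℕ) + 1 ≤ (s : ℕ) + ∑ k ∈ W, (a : κ → ℕ) k then (1 : ℝ) else 0)

/-! ### 1. The exact giants ⊗ smalls factorisation -/

/-- **EXACT giants ⊗ smalls factorisation.**  For any finset `G` of giants (`j + 1 ≤ s + a k` for `k ∈ G`):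
`1 − TERM[s, a, g, j] = (∏_{k∈G} (1 − g k)) · (1 − TERM[s, a|_{G↦0}, g, j])`, where `a|_{G↦0}` empties the giants — the event
'`s + N ≤ j`' is 'every giant closed and the remaining blobs fail', and the blobs are independent.  (Induction on `G` with `term_cond`:
for a giant `k`, `1 − TERM = (1 − g k)·(1 − TERM[a[k↦0]])`.) [this work] -/
theorem one_sub_term_eq_giants (s : ℕ) (a : κ → ℕ) (g : κ → ℝ) (j : ℕ) (G : Finset κ) (hG : ∀ k ∈ G, j + 1 ≤ s + a k) :
    1 - TERM[s, a, g, j] = (∏ k ∈ G, (1 - g k)) * (1 - TERM[s, (fun k => if k ∈ G then 0 else a k), g, j]) := by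
  induction G using Finset.induction_on generalizing a with
  | empty =>
    have e : (fun k => if k ∈ (∅ : Finset κ) then 0 else a k) = a := funext fun k => by simp
    rw [Finset.prod_empty, one_mul, e]
  | @insert k G hkG ih =>
    have hk : j + 1 ≤ s + a k := hG k (Finset.mem_insert_self k G)
    have hG' : ∀ k' ∈ G, j + 1 ≤ s + Function.update a k 0 k' := by
      intro k' hk'
      rw [Function.update_of_ne (ne_of_mem_of_not_mem hk' hkG)]
      exact hG k' (Finset.mem_insert_of_mem hk')
    have ih' := ih (Function.update a k 0) hG'
    have e : (fun i => if i ∈ G then 0 else Function.update a k 0 i) = (fun i => if i ∈ insert k G then 0 else a i) := by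
      funext i
      by_cases hik : i = k
      · subst hik
        simp [hkG]
      · simp [Finset.mem_insert, hik]
    rw [term_cond s a g j k, term_eq_one_of_sure (s + a k) _ g j hk, Finset.prod_insert hkG, ← e, mul_assoc, ← ih']
    ring

/-- **Giants ⊗ smalls as a certificate.**  Gates in `[0,1]`, `G` a finset of giants, the smalls certified at `w`
(`w ≤ TERM[s, a|_{G↦0}, g, j]`) and `z ≤ 1 − ∏_{k∈G}(1 − g k)·(1 − w)` ⟹ `z ≤ TERM[s, a, g, j]`.  With `w = 0` this is
`term_ge_disj_giants`. [this work] -/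
theorem term_ge_of_giants_smalls (s : ℕ) (a : κ → ℕ) (g : κ → ℝ) (j : ℕ) (hg : ∀ k, 0 ≤ g k ∧ g k ≤ 1) (G : Finset κ)
    (hG : ∀ k ∈ G, j + 1 ≤ s + a k) (z w : ℝ) (hw : w ≤ TERM[s, (fun k => if k ∈ G then 0 else a k), g, j])
    (hz : z ≤ 1 - (∏ k ∈ G, (1 - g k)) * (1 - w)) : z ≤ TERM[s, a, g, j] := by
  have hP : 0 ≤ ∏ k ∈ G, (1 - g k) := Finset.prod_nonneg fun k _ => by linarith [(hg k).2]
  have h := one_sub_term_eq_giants s a g j G hG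
  have h2 : (∏ k ∈ G, (1 - g k)) * (1 - TERM[s, (fun k => if k ∈ G then 0 else a k), g, j]) ≤
      (∏ k ∈ G, (1 - g k)) * (1 - w) := mul_le_mul_of_nonneg_left (by linarith) hP
  linarith

/-! ### 2. Markov on the closed mass -/

/-- **Markov on the closed mass, as a TERM rule.**  Gates in `[0,1]`, `s ≤ j`, total size `A = Σ a` with `j − s < A`, mean `m = Σ a·g`:
`(m − (j − s))/(A − (j − s)) ≤ TERM[s, a, g, j]`, from `(A − (j − s))·P(N ≤ j − s) ≤ A − m` (`IndepBlob.heavy_fail_markov`). [this work] -/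
theorem term_ge_of_markov (s : ℕ) (a : κ → ℕ) (g : κ → ℝ) (j : ℕ) (hg : ∀ k, 0 ≤ g k ∧ g k ≤ 1) (hs : s ≤ j)
    (hA : ((j - s : ℕ) : ℝ) < ∑ k, (a k : ℝ)) :
    ((∑ k, (a k : ℝ) * g k) - ((j - s : ℕ) : ℝ)) / ((∑ k, (a k : ℝ)) - ((j - s : ℕ) : ℝ)) ≤ TERM[s, a, g, j] := by
  rw [term_eq_one_sub s a g j hs]
  have key := IndepBlob.heavy_fail_markov g (fun k => (hg k).1) (fun k => (hg k).2) a ((j - s : ℕ) : ℝ)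
  have hfilt : (Finset.univ : Finset (Finset κ)).filter (fun W => ((∑ k ∈ W, a k : ℕ) : ℝ) ≤ ((j - s : ℕ) : ℝ)) =
      (Finset.univ : Finset (Finset κ)).filter (fun W => ∑ k ∈ W, a k ≤ j - s) := by
    ext W
    simp only [Finset.mem_filter, Finset.mem_univ, true_and, Nat.cast_le]
  rw [hfilt] at key
  have hCt : 0 < (∑ k, (a k : ℝ)) - ((j - s : ℕ) : ℝ) := by linarith
  rw [div_le_iff₀ hCt]
  have e : (1 - ∑ W ∈ (Finset.univ : Finset (Finset κ)).filter (fun W => ∑ k ∈ W, a k ≤ j - s), wt[g, W]) *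
      ((∑ k, (a k : ℝ)) - ((j - s : ℕ) : ℝ)) = ((∑ k, (a k : ℝ)) - ((j - s : ℕ) : ℝ)) -
      ((∑ k, (a k : ℝ)) - ((j - s : ℕ) : ℝ)) *
        ∑ W ∈ (Finset.univ : Finset (Finset κ)).filter (fun W => ∑ k ∈ W, a k ≤ j - s), wt[g, W] := by ring
  rw [e]
  linarith

/-! ### 3. Rule δ½ — a light giant sends the rest into the kernel half -/

/-- `2x − 1 ≤ x²` — so every light of positive discounted credit (`g > x²`) has gate `≥ 2x − 1`. [this work] -/
theorem two_mul_sub_one_le_sq (x : ℝ) : 2 * x - 1 ≤ x ^ 2 := by nlinarith [sq_nonneg (x - 1)]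

/-- Behind a giant of gate `g ≥ 2x − 1`, `g < 1`, the floor the rest must reach is `(x − g)/(1 − g) ≤ 1/2`. [this work] -/
theorem lightGiant_floor_le_half (x g : ℝ) (hg : 2 * x - 1 ≤ g) (hg1 : g < 1) : (x - g) / (1 - g) ≤ 1 / 2 := by
  rw [div_le_iff₀ (by linarith)]
  linarith

/-- With `w = (x − g)/(1 − g)` (`g < 1`): `g + (1 − g)·w = x`. [this work] -/
theorem gate_add_mul_lightGiant_floor (x g : ℝ) (hg1 : g < 1) : g + (1 - g) * ((x - g) / (1 - g)) = x := by
  have h : (1 - g) ≠ 0 := by linarith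
  field_simp
  ring

/-- **Rule δ½ (a light giant + the kernel half).**  Gates in `[0,1]`, a giant `k` (`j + 1 ≤ s + a k`) of any gate, a floor `w ≤ 1/2` with
`x ≤ g k + (1 − g k)·w`, and the REST (blob `k` emptied, sure part `s`) certified at `w` by the kernel half of DIB\* — capped discounted credit
at floor `w` exceeding `2(j − s)` (`term_ge_of_credit_of_le_half`) ⟹ `x ≤ TERM[s, a, g, j]`.  For a light giant of gate `g ≥ 2x − 1` the floor
`w = (x − g)/(1 − g)` qualifies (`lightGiant_floor_le_half`, `gate_add_mul_lightGiant_floor`). [this work] -/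
theorem term_ge_of_lightGiant_half (s : ℕ) (a : κ → ℕ) (g : κ → ℝ) (j : ℕ) (hg : ∀ k, 0 ≤ g k ∧ g k ≤ 1) (k : κ)
    (hk : j + 1 ≤ s + a k) (x w : ℝ) (hw : w ≤ 1 / 2) (hconv : x ≤ g k + (1 - g k) * w)
    (hrest : (2 * j : ℝ) < 2 * s + ∑ i, (if w ≤ g i then ((Function.update a k 0 i : ℕ) : ℝ) * g i
      else ((min (Function.update a k 0 i) (j - s) : ℕ) : ℝ) * max ((g i - w ^ 2) / (1 - w)) 0)) :
    x ≤ TERM[s, a, g, j] := by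
  have h0 := term_ge_of_credit_of_le_half s (Function.update a k 0) g j w hw hg hrest
  refine term_ge_of_floorSplit s a g j k x 1 w (hg k) ?_ h0 (by linarith)
  rw [term_eq_one_of_sure (s + a k) _ g j hk]

/-! ### 4. Giants ⊗ smalls with the smalls in the kernel half -/

/-- If `∏_G(1 − g) ≤ 2(1 − x)` and the product is positive, the floor `w⋆ = 1 − (1 − x)/∏_G(1 − g)` is `≤ 1/2`. [this work] -/
theorem giants_halfFloor_le_half (x P : ℝ) (hP0 : 0 < P) (hP : P ≤ 2 * (1 - x)) : 1 - (1 - x) / P ≤ 1 / 2 := by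
  rw [show 1 - (1 - x) / P = (P - (1 - x)) / P from by field_simp, div_le_iff₀ hP0]
  linarith

/-- … and it turns the product condition into an equality: `P·(1 − w⋆) = 1 − x`. [this work] -/
theorem giants_halfFloor_eq (x P : ℝ) (hP0 : 0 < P) : P * (1 - (1 - (1 - x) / P)) = 1 - x := by
  field_simp
  ring

omit [Fintype κ] in
/-- A product of factors in `[0,1]` is at most any one of them: `∏_G (1 − g) ≤ 1 − g k₀` for `k₀ ∈ G`. [this work] -/
theorem prod_one_sub_le_factor (g : κ → ℝ) (hg : ∀ k, 0 ≤ g k ∧ g k ≤ 1) (G : Finset κ) (k₀ : κ) (hk₀ : k₀ ∈ G) :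
    ∏ k ∈ G, (1 - g k) ≤ 1 - g k₀ := by
  rw [← Finset.mul_prod_erase G (fun k => 1 - g k) hk₀]
  have h1 : ∏ k ∈ G.erase k₀, (1 - g k) ≤ 1 :=
    Finset.prod_le_one (fun k _ => by linarith [(hg k).2]) (fun k _ => by linarith [(hg k).1])
  have h0 : 0 ≤ 1 - g k₀ := by linarith [(hg k₀).2]
  nlinarith

/-- **Giants ⊗ smalls in the kernel half.**  Gates in `[0,1]`, `G` a finset of giants, a floor `w ≤ 1/2` with `∏_G(1 − g)·(1 − w) ≤ 1 − x`, and
the smalls (`a|_{G↦0}`, sure part `s`) certified at `w` by the kernel half of DIB\* (capped discounted credit at floor `w` exceeding `2(j − s)`)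
⟹ `x ≤ TERM[s, a, g, j]`.  By `giants_halfFloor_le_half` the half-floor is enough whenever `∏_G(1 − g) ≤ 2(1 − x)`, e.g. as soon as one
giant has gate `≥ 2x − 1` (`prod_one_sub_le_factor`). [this work] -/
theorem term_ge_of_giants_half (s : ℕ) (a : κ → ℕ) (g : κ → ℝ) (j : ℕ) (hg : ∀ k, 0 ≤ g k ∧ g k ≤ 1) (G : Finset κ)
    (hG : ∀ k ∈ G, j + 1 ≤ s + a k) (x w : ℝ) (hw : w ≤ 1 / 2) (hconv : (∏ k ∈ G, (1 - g k)) * (1 - w) ≤ 1 - x)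
    (hrest : (2 * j : ℝ) < 2 * s + ∑ i, (if w ≤ g i then (((if i ∈ G then 0 else a i : ℕ)) : ℝ) * g i
      else ((min (if i ∈ G then 0 else a i) (j - s) : ℕ) : ℝ) * max ((g i - w ^ 2) / (1 - w)) 0)) :
    x ≤ TERM[s, a, g, j] :=
  term_ge_of_giants_smalls s a g j hg G hG x w
    (term_ge_of_credit_of_le_half s (fun i => if i ∈ G then 0 else a i) g j w hw hg hrest) (by linarith)

end RootDec

end Quant

end Summit.CriticalPhenomena.PercolationContinuityZ3.Theorems
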